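import Summits.ValiantsHypothesis.ValiantsHypothesis.Theorems.BarrierLeverAnchoredDoorHitsLowerPairsPTReduction
import Summits.ValiantsHypothesis.ValiantsHypothesis.Theorems.BarrierLeverAnchoredDoorHitsLowerPairsXElimRSWXZ

/-!
# Support item `AnchoredDoorHitsLowerPairs` (stmt-ValiantsHypothesis-22510), line `anchored-peeling`:
# CONJECTURE Z′ — THE TAIL-GRADED DOMINANT PROBLEM — AS ONE ORIENTATION-FREE NODE CLOSING THE RESIDUAL

Helper file (`--supports stmt-ValiantsHypothesis-22510`; cell valiant-natproofs, rung V4; prover seat val-np-p1 gen 26; memo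
HOME/val-np-p1/g26/MEMO-conjZ-node-valnp1-g26.md §13). Closes NO item; OFFERS a registry alternative (planner's call).

Conjecture Z (`Stmt.stub_conjZ`, p695484) is the profile-2 dominant problem WITHOUT `y`-tails; it needs profile-2 nested Hall and therefore an
orientation, and the orientation lemma is false (memo §1) — whence the glued pair (Z, RSWZ) of registry v27/v28. The tail-graded reduction K1′
(`PT.symbolicDet_ne_zero_of_ptEntry`, `…PTReduction`) applies to EVERY pair: for row potentials `a` and column discounts `c` (the dual potentials of a
minimum-tail-count perfect matching) the bottom `T`-coefficient of the column-scaled evaluated minor is the determinant of the tail-graded dominant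
entries on the tight edges. **CONJECTURE Z′** (`Stmt.stub_conjZprime`): for every injective doubly-lower pair there are admissible potentials and complex
`Θ Φ Ψ` making that determinant nonzero. Kernel arrows (all unconditional given Z′): `symbolicDet_two_ne_zero_of_conjZprime`, `…_of_conjZprime` for
`s ≥ 2`, `stub_ltRestNonCanonRSW_of_conjZprime` (Z′ ⟹ the residual of record v26 OUTRIGHT, at `s = 2`), `stub_ltRestNonCanonRSWZ_of_conjZprime`,
`stub_ltRestNonCanonRSWXZ_of_conjZprime`, and BY NAME `anchoredDoorHitsLowerPairs_of_conjZprime : Stmt.stub_conjZprime → AnchoredDoorHitsLowerPairs`.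

EVIDENCE (numerics, exact mod p; lab/k1prime.py): kit j327370 — 938 random lower pairs (r ≤ 160), the tight dominant determinant is nonzero in BOTH
orientations for all, including the 228 orientations where nested Hall fails (K1 dead); the doubly non-nested-Hall pair (Δ⁶ ⊔ 104 points, tB(11,3)),
r = 232: nonzero (a = 1 on singleton rows, c = 1 on columns of size ≤ 2); kit j327482 — random doubly non-nested-Hall pairs (r ≈ 190–250). WHY IT MIGHT
FAIL: a lower pair all of whose minimum-tail tight patterns give a singular dominant matrix while the symbolic minor survives through cancellation-free
higher tail counts — none known.

WHAT THIS IS NOT: Z′ is not proved; nothing on crux stmt-ValiantsHypothesis-14610 or on `VP` versus `VNP`.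
-/

set_option linter.dupNamespace false

namespace Summit.ValiantsHypothesis.ValiantsHypothesis.Theorems.BarrierLever.AnchoredPeeling

/-- **CONJECTURE Z′ (the tail-graded dominant problem at profile 2; orientation-free).** For every `h`, `r` and every pair of injective enumerations
`u`, `w` of lower families in `Fin h`, there are row potentials `a`, column discounts `c`, admissible (`a i ≤ c j` or `a i + 2|u i| ≤ |w j| + c j`),
and complex `Θ Φ Ψ` such that the tail-graded dominant matrix `([c j ≤ a i] · PT.ptEntry 2 (a i − c j) Θ Φ Ψ (w j) (u i))_{i j}` is nonsingular. -/
def Stmt.stub_conjZprime : Prop :=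
  ∀ (h r : ℕ) (u w : Fin r → Finset (Fin h)), Function.Injective u → Function.Injective w →
    IsLowerSet (Set.range u) → IsLowerSet (Set.range w) →
    ∃ (a c : Fin r → ℕ), (∀ i j, a i ≤ c j ∨ a i + 2 * (u i).card ≤ (w j).card + c j) ∧
      ∃ (Θ : Finset (Fin h) × Finset (Fin h) → ℂ) (Φ Ψ : Finset (Fin h) × Finset (Fin h) → Fin h → ℂ),
        (Matrix.of fun i j : Fin r => if c j ≤ a i then PT.ptEntry 2 (a i - c j) Θ Φ Ψ (w j) (u i) else 0).det ≠ 0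

/-- **Z′ ⟹ profile-2 hits for every doubly-lower injective pair** (K1′, `PT.symbolicDet_ne_zero_of_ptEntry`). -/
theorem symbolicDet_two_ne_zero_of_conjZprime (hZ : Stmt.stub_conjZprime) {h r : ℕ} (u w : Fin r → Finset (Fin h))
    (hu : Function.Injective u) (hw : Function.Injective w) (hlu : IsLowerSet (Set.range u)) (hlw : IsLowerSet (Set.range w)) :
    symbolicDet 2 h r u w ≠ 0 := by
  obtain ⟨a, c, hac, Θ, Φ, Ψ, hdet⟩ := hZ h r u w hu hw hlu hlw
  exact PT.symbolicDet_ne_zero_of_ptEntry Θ Φ Ψ u w a c hac hdet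

/-- **Z′ ⟹ hits at every profile `s ≥ 2`** (`symbolicDet_ne_zero_mono`). -/
theorem symbolicDet_ne_zero_of_conjZprime (hZ : Stmt.stub_conjZprime) {s h r : ℕ} (hs : 2 ≤ s) (u w : Fin r → Finset (Fin h))
    (hu : Function.Injective u) (hw : Function.Injective w) (hlu : IsLowerSet (Set.range u)) (hlw : IsLowerSet (Set.range w)) :
    symbolicDet s h r u w ≠ 0 :=
  symbolicDet_ne_zero_mono hs (symbolicDet_two_ne_zero_of_conjZprime hZ u w hu hw hlu hlw)

/-- **Z′ ⟹ the registered residual of v26 `Stmt.stub_ltRestNonCanonRSW` OUTRIGHT** (at `s = 2`, `h₀ = 0`; none of its side hypotheses is used). -/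
theorem stub_ltRestNonCanonRSW_of_conjZprime (hZ : Stmt.stub_conjZprime) : Stmt.stub_ltRestNonCanonRSW := by
  refine ⟨2, 0, by norm_num, ?_⟩
  intro h _ r u w hu hw hlu hlw _ _ _ _ _ _ _ _ _ _ _ _ _
  exact symbolicDet_two_ne_zero_of_conjZprime hZ u w hu hw hlu hlw

/-- **Z′ ⟹ the residual of record v27 `Stmt.stub_ltRestNonCanonRSWZ`.** -/
theorem stub_ltRestNonCanonRSWZ_of_conjZprime (hZ : Stmt.stub_conjZprime) : Stmt.stub_ltRestNonCanonRSWZ := by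
  refine ⟨2, 0, le_refl 2, ?_⟩
  intro h _ r u w hu hw hlu hlw _ _ _ _ _ _ _ _ _ _ _ _ _ _ _
  exact symbolicDet_two_ne_zero_of_conjZprime hZ u w hu hw hlu hlw

/-- **Z′ ⟹ the residual `Stmt.stub_ltRestNonCanonRSWXZ`** (v28 candidate, p703257). -/
theorem stub_ltRestNonCanonRSWXZ_of_conjZprime (hZ : Stmt.stub_conjZprime) : Stmt.stub_ltRestNonCanonRSWXZ :=
  stub_ltRestNonCanonRSWXZ_of_rswz (stub_ltRestNonCanonRSWZ_of_conjZprime hZ)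

/-- **Composition BY NAME (single-node registry candidate): `Stmt.stub_conjZprime → AnchoredDoorHitsLowerPairs`.** -/
theorem anchoredDoorHitsLowerPairs_of_conjZprime (hZ : Stmt.stub_conjZprime) :
    Summit.ValiantsHypothesis.ValiantsHypothesis.Theses.BarrierLever.AnchoredDoorHitsLowerPairs :=
  anchoredDoorHitsLowerPairs_of_ltRestNonCanonRSW (stub_ltRestNonCanonRSW_of_conjZprime hZ)

end Summit.ValiantsHypothesis.ValiantsHypothesis.Theorems.BarrierLever.AnchoredPeeling
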